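import Summits.ResolutionOfSingularities.ResolutionOfSingularities.Theses.PAlteration
import Summits.ResolutionOfSingularities.ResolutionOfSingularities.Theorems.PAlterationPialtKnownCases
import Literature.AlgebraicGeometry.Resolution.GeneralLU
import Literature.AlgebraicGeometry.Resolution.ProperModelsPatchingOfResolution
import Literature.AlgebraicGeometry.Resolution.ProperModelsFunctionField
import Literature.AlgebraicGeometry.Resolution.AlterationsDimension
import Literature.AlgebraicGeometry.Motives.CyclesDimensionFunctionField
import Literature.AlgebraicGeometry.Motives.VarietiesProperProofs
import HarnessLib

/-!
# Crux `Pialt` (stmt-ResolutionOfSingularities-0555): the OPEN RANGE of the registered open atoms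
# — each holds in dimension / transcendence degree `≤ 3` modulo `CossartPiltant2019`

Line lead c3 (prover-line-stmt-ResolutionOfSingularities-0555-c3-0, 2026-08-17), `--supports`
stmt-ResolutionOfSingularities-0555. The two live skeletons of the crux are at open atoms:

* `Cruxes/Pialt/Lines/SketchIdeator2.lean` (registered): `stub_rrLU1Perfect` (local
  uniformization below height-one Frobenius sandwiches over perfect fields) and
  `stub_twoModelPatchingPerfect` (Piltant's two-model patching of proper models over perfect
  fields), next to the named fact `stub_temkin2013`;
* `Cruxes/Pialt/Lines/IndeterminacySplit.lean` (strategist's exact alternative):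
  `stub_frobIndet` and `stub_hypersurfacePialt`.

Their docstrings say "open from dimension / transcendence degree `4`". This file makes the
positive half of that claim a kernel fact for three of them, in the registered binder shape with
ONE extra hypothesis (`Algebra.trdeg k K ≤ 3`, resp. `n ≤ 3`) and modulo the named fact
`CossartPiltant2019` (resolution of reduced separated schemes of finite type of dimension `≤ 3`
over a field, Cossart–Piltant 2019 Thm. 1.1):

* `rrLU1Perfect_of_trdeg_le_three` — from Cossart–Piltant's local uniformization in
  transcendence degree `≤ 3` (`CossartPiltant2019.relLocalUniformization`): the valuation ring
  `O ∩ K` of `K` is uniformized on `K` itself; the sandwich `K ⊆ L`, the regular model `B` and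
  perfectness of `k` are idle;
* `twoModelPatchingPerfect_of_trdeg_le_three` — resolve the join of the two proper models
  (`ProperModel.exists_hom_isRegular_of_hasResolution`), which has dimension `trdeg_k K ≤ 3`
  (`properModel_topologicalKrullDim_eq_of_trdeg`, proved here: `dim M = trdeg_k K(M)`,
  Görtz–Wedhorn I Thm. 5.22 (3), and `K(M) ≅ K` over `k`);
* `hypersurfacePialt_of_le_three` — an integral hypersurface `H ⊆ ℙⁿ⁺¹_k` of dimension `n ≤ 3`
  is proper over `k`, so `pialtConclusion_of_dim_le_three` applies.

So a counterexample to any of these three atoms lives in dimension `≥ 4`; for the two Card A atoms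
it is moreover a counterexample to resolution in characteristic `p` over a perfect field
(`rrLU1Perfect_of_localUniformizationInChar`, `twoModelPatchingPerfect_of_resolutionInChar`,
`Theorems/PAlterationPialtSplitGlue.lean`). (The fourth atom, `stub_frobIndet`, is calibrated in
a separate file through the closure of the graph.)
-/

set_option linter.dupNamespace false

noncomputable section

open CategoryTheory CategoryTheory.Limits AlgebraicGeometry TopologicalSpace Order
open Literature.AlgebraicGeometry.Resolution
open Literature.AlgebraicGeometry.Motives (projectiveSpace isProper_projectiveSpace)

namespace Summit.ResolutionOfSingularities.ResolutionOfSingularities.Theorems.Pialt.OpenRange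

universe u

/-! ## `stub_rrLU1Perfect` in transcendence degree `≤ 3` -/

/-- **Local uniformization of `O ∩ K` in transcendence degree `≤ 3`** (Cossart–Piltant): for
fields `k ⊆ K ⊆ L` with `K/k` finitely generated of transcendence degree `≤ 3` and a valuation
ring `O` of `L` containing `k`, the valuation ring `O ∩ K` of `K` is locally uniformizable over
`k`, modulo `CossartPiltant2019` (an affine model of `K` inside `O ∩ K` exists,
`exists_affineModel`; Cossart–Piltant's relative local uniformization in transcendence degree
`≤ 3`, `CossartPiltant2019.relLocalUniformization`, refines it to one regular at the centre).
[cite: CossartPiltant2019, Thm. 1.1 with §4.1 (LU)] -/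
theorem isLocallyUniformizable_comap_of_trdeg_le_three (hCP : CossartPiltant2019.{0})
    {k K L : Type} [Field k] [Field K] [Field L] [Algebra k K] [Algebra K L] [Algebra k L]
    [IsScalarTower k K L] (hfg : (⊤ : IntermediateField k K).FG) (htr : Algebra.trdeg k K ≤ 3)
    (O : ValuationSubring L) (hO : ∀ c : k, algebraMap k L c ∈ O) :
    IsLocallyUniformizable k K (O.comap (algebraMap K L)) := by
  set O' : ValuationSubring K := O.comap (algebraMap K L) with hO'
  have hkO' : ∀ c : k, algebraMap k K c ∈ O' := by
    intro c
    change algebraMap K L (algebraMap k K c) ∈ O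
    rw [← IsScalarTower.algebraMap_apply]
    exact hO c
  obtain ⟨A, hAO, hAfg, hAfr⟩ := exists_affineModel k K hfg O' hkO'
  obtain ⟨A', h', hle, hfg', hreg⟩ :=
    hCP.relLocalUniformization k K htr O' A hAfg hAfr hAO
  exact ⟨A', h', hfg', isFractionRing_of_le hle hAfr, hreg⟩

/-- **`stub_rrLU1Perfect` holds in transcendence degree `≤ 3` modulo `CossartPiltant2019`** —
the registered atom of `Cruxes/Pialt/Lines/SketchIdeator2.lean` with its binders verbatim and the
single extra hypothesis `Algebra.trdeg k K ≤ 3`: the height-one sandwich `K ⊆ L = K(y)`, the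
regular model `B ⊆ O` of `L` and perfectness of `k` are not used (Cossart–Piltant uniformize
`O ∩ K` on `K` itself). So the atom is OPEN exactly from transcendence degree `4`.
[cite: CossartPiltant2019, Thm. 1.1 with §4.1 (LU)] -/
theorem rrLU1Perfect_of_trdeg_le_three (hCP : CossartPiltant2019.{0}) (p : ℕ) (_hp : p.Prime) :
    ∀ (k K L : Type) [Field k] [CharP k p] [PerfectField k] [Field K] [Field L] [Algebra k K]
      [Algebra K L] [Algebra k L] [IsScalarTower k K L], (⊤ : IntermediateField k K).FG →
      Algebra.trdeg k K ≤ 3 → IsPurelyInseparable K L →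
      (∃ y : L, y ^ p ∈ (algebraMap K L).range ∧ IntermediateField.adjoin K {y} = ⊤) →
      ∀ B : Subalgebra k L, B.FG → IsFractionRing B L → IsRegularRing B →
      ∀ O : ValuationSubring L, B.toSubring ≤ O.toSubring →
        IsLocallyUniformizable k K (O.comap (algebraMap K L)) := by
  intro k K L _ _ _ _ _ _ _ _ _ hfg htr _ _ B _ _ _ O hBO
  exact isLocallyUniformizable_comap_of_trdeg_le_three hCP hfg htr O
    fun c => hBO (B.algebraMap_mem c)

/-! ## The dimension of a proper model is the transcendence degree -/

/-- The `k`-algebra structure on the function field `K(M)` of a proper model `M` of `K/k`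
(transported from `K`, `ProperModel.algebraFunctionField`) is the geometric one
`k = Γ(Spec k) → Γ(M, 𝒪) → K(M)`: both induce `Spec K(M) → M → Spec k`
(`ProperModel.fromSpecStalk_genericPoint_π`; port of `ProjModel.algebraMap_functionField_eq_germ`).
[folklore] -/
theorem properModel_algebraMap_functionField_eq_germ {k K : Type u} [Field k] [Field K]
    [Algebra k K] (M : ProperModel k K) :
    algebraMap k M.X.functionField =
      (M.X.presheaf.germ ⊤ (genericPoint M.X) trivial).hom.comp
        (M.π.appTop.hom.comp (Scheme.ΓSpecIso (.of k)).inv.hom) := by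
  set ψ₀ : k →+* M.X.functionField := (M.X.presheaf.germ ⊤ (genericPoint M.X) trivial).hom.comp
    (M.π.appTop.hom.comp (Scheme.ΓSpecIso (.of k)).inv.hom) with hψ₀
  have e1 : (Spec (CommRingCat.of k)).toSpecΓ ≫ Spec.map (Scheme.ΓSpecIso (.of k)).inv = 𝟙 _ := by
    rw [← SpecMap_ΓSpecIso_hom, ← Spec.map_comp, Iso.inv_hom_id, Spec.map_id]
  have h1 : Spec.map (CommRingCat.ofHom ψ₀) = M.X.fromSpecStalk (genericPoint M.X) ≫ M.π := by
    calc Spec.map (CommRingCat.ofHom ψ₀)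
        = Spec.map (M.X.presheaf.germ ⊤ (genericPoint M.X) trivial) ≫ Spec.map M.π.appTop ≫
            Spec.map (Scheme.ΓSpecIso (.of k)).inv := by
          rw [hψ₀, show CommRingCat.ofHom ((M.X.presheaf.germ ⊤ (genericPoint M.X) trivial).hom.comp
              (M.π.appTop.hom.comp (Scheme.ΓSpecIso (.of k)).inv.hom)) =
            (Scheme.ΓSpecIso (.of k)).inv ≫ M.π.appTop ≫
              M.X.presheaf.germ ⊤ (genericPoint M.X) trivial from rfl,
            Spec.map_comp, Spec.map_comp, Category.assoc]
      _ = M.X.fromSpecStalk (genericPoint M.X) ≫ M.X.toSpecΓ ≫ Spec.map M.π.appTop ≫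
            Spec.map (Scheme.ΓSpecIso (.of k)).inv := by rw [Scheme.fromSpecStalk_toSpecΓ_assoc]
      _ = M.X.fromSpecStalk (genericPoint M.X) ≫ M.π ≫ (Spec (CommRingCat.of k)).toSpecΓ ≫
            Spec.map (Scheme.ΓSpecIso (.of k)).inv := by rw [Scheme.toSpecΓ_naturality_assoc M.π]
      _ = M.X.fromSpecStalk (genericPoint M.X) ≫ M.π := by rw [e1, Category.comp_id]
  rw [M.fromSpecStalk_genericPoint_π] at h1
  have h2 := Spec.map_injective h1
  exact (congrArg CommRingCat.Hom.hom h2).symm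

/-- **`dim M = trdeg_k K` for a proper model `M` of `K/k`** (Görtz–Wedhorn I, Thm. 5.22 (3):
`dim X = trdeg_k K(X)` for an integral `X` locally of finite type over `k`,
`Motives.height_top_eq_trdeg`; and `K(M) ≅ K` over `k`, `ProperModel.funFieldAlgEquiv`). The
proper-model twin of `ProjModel.topologicalKrullDim_eq_of_trdeg`.
[cite: GortzWedhorn2020, Thm. 5.22 (3)] -/
theorem properModel_topologicalKrullDim_eq_of_trdeg {k K : Type u} [Field k] [Field K]
    [Algebra k K] (M : ProperModel k K) {d : ℕ} (htr : Algebra.trdeg k K = d) :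
    topologicalKrullDim M.X = d := by
  have h := Literature.AlgebraicGeometry.Motives.height_top_eq_trdeg M.π
  have hinst : ((M.X.presheaf.germ ⊤ (genericPoint M.X) trivial).hom.comp
      (M.π.appTop.hom.comp (Scheme.ΓSpecIso (.of k)).inv.hom)).toAlgebra =
        ProperModel.algebraFunctionField M :=
    Algebra.algebra_ext _ _ fun c =>
      (RingHom.congr_fun (properModel_algebraMap_functionField_eq_germ M) c).symm
  rw [hinst, M.funFieldAlgEquiv.trdeg_eq, htr, Cardinal.toNat_natCast] at h
  rw [← Literature.AlgebraicGeometry.Motives.Scheme.height_genericPoint]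
  exact h

/-- `dim M ≤ d` for a proper model `M` of `K/k` with `trdeg_k K ≤ d` (the transcendence degree of
an essentially-finite-type field extension is finite, so it is a natural number `≤ d`).
[cite: GortzWedhorn2020, Thm. 5.22 (3)] -/
theorem properModel_topologicalKrullDim_le_of_trdeg_le {k K : Type u} [Field k] [Field K]
    [Algebra k K] (M : ProperModel k K) {d : ℕ} (htr : Algebra.trdeg k K ≤ d) :
    topologicalKrullDim M.X ≤ d := by
  -- `trdeg_k K` is a natural number: it is `≤ d`
  obtain ⟨n, hn⟩ : ∃ n : ℕ, Algebra.trdeg k K = n := by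
    have hlt : Algebra.trdeg k K < Cardinal.aleph0 :=
      lt_of_le_of_lt htr (Cardinal.natCast_lt_aleph0 (n := d))
    exact Cardinal.lt_aleph0.mp hlt
  rw [properModel_topologicalKrullDim_eq_of_trdeg M hn]
  have hnd : n ≤ d := by exact_mod_cast (hn ▸ htr : (n : Cardinal) ≤ d)
  exact_mod_cast hnd

/-! ## `stub_twoModelPatchingPerfect` in transcendence degree `≤ 3` -/

/-- **Two-model patching of proper models in transcendence degree `≤ 3`** (any ground field),
modulo `CossartPiltant2019`: the join `M₁ ⋈ M₂` is a proper model of dimension `trdeg_k K ≤ 3`,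
so it has a resolution of singularities, which is a REGULAR proper model dominating both
(`ProperModel.exists_hom_isRegular_of_hasResolution`); a regular model is `RegLe` over every
model it dominates. [cite: CossartPiltant2019, Thm. 1.1] -/
theorem twoModelPatching_of_trdeg_le_three (hCP : CossartPiltant2019.{0}) {k : Type} [Field k]
    {K : Type} [Field K] [Algebra k K] (htr : Algebra.trdeg k K ≤ 3) (M₁ M₂ : ProperModel k K) :
    ∃ (N : ProperModel k K) (φ₁ : N.Hom M₁) (φ₂ : N.Hom M₂), φ₁.RegLe ∧ φ₂.RegLe := by
  let J := ProperModel.join M₁ M₂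
  have hdim : topologicalKrullDim J.X ≤ 3 :=
    properModel_topologicalKrullDim_le_of_trdeg_le J (d := 3) (by exact_mod_cast htr)
  haveI : IsReduced J.X := inferInstance
  have hres : Scheme.HasResolution J.X :=
    hCP k J.X J.π inferInstance inferInstance inferInstance inferInstance hdim
  obtain ⟨N, φ, hN⟩ := J.exists_hom_isRegular_of_hasResolution hres
  exact ⟨N, φ.comp (ProperModel.joinFst M₁ M₂), φ.comp (ProperModel.joinSnd M₁ M₂),
    fun y _ => hN y, fun y _ => hN y⟩

/-- **`stub_twoModelPatchingPerfect` holds in transcendence degree `≤ 3` modulo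
`CossartPiltant2019`** — the registered atom of `Cruxes/Pialt/Lines/SketchIdeator2.lean` with its
binders verbatim and the single extra hypothesis `Algebra.trdeg k K ≤ 3` (perfectness and the
characteristic are idle). So the atom is OPEN exactly from transcendence degree `4`.
[cite: CossartPiltant2019, Thm. 1.1] -/
theorem twoModelPatchingPerfect_of_trdeg_le_three (hCP : CossartPiltant2019.{0}) (p : ℕ)
    (_hp : p.Prime) :
    ∀ (k : Type) [Field k] [CharP k p] [PerfectField k] (K : Type) [Field K] [Algebra k K]
      [Algebra.EssFiniteType k K], Algebra.trdeg k K ≤ 3 → ∀ M₁ M₂ : ProperModel k K,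
        ∃ (N : ProperModel k K) (φ₁ : N.Hom M₁) (φ₂ : N.Hom M₂), φ₁.RegLe ∧ φ₂.RegLe :=
  fun _ _ _ _ _ _ _ _ htr M₁ M₂ => twoModelPatching_of_trdeg_le_three hCP htr M₁ M₂

/-! ## `stub_hypersurfacePialt` for `n ≤ 3` -/

/-- **`stub_hypersurfacePialt` holds for hypersurfaces of dimension `n ≤ 3` modulo
`CossartPiltant2019`** — the registered atom of `Cruxes/Pialt/Lines/IndeterminacySplit.lean` with
its binders verbatim and the single extra hypothesis `n ≤ 3`: an integral closed subscheme `H` of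
`ℙⁿ⁺¹_k` is proper over `k` (`isProper_projectiveSpace`), so the crux conclusion at `H` is the
known case `pialtConclusion_of_dim_le_three` (Cossart–Piltant resolve `H`; a resolution is a
purely inseparable regular alteration). Perfectness and the characteristic are idle. So the atom
is OPEN exactly from `n = 4`. [cite: CossartPiltant2019, Thm. 1.1] -/
theorem hypersurfacePialt_of_le_three (hCP : CossartPiltant2019.{0}) (p : ℕ) (_hp : p.Prime)
    (k : Type) [Field k] [CharP k p] [PerfectField k] (n : ℕ) (hn : n ≤ 3) (H : Scheme.{0})
    (ι : H ⟶ (Literature.AlgebraicGeometry.Motives.projectiveSpace (n + 1) k).left)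
    [IsClosedImmersion ι] [IsIntegral H] (hdim : topologicalKrullDim H = (n : WithBot ℕ∞)) :
    ∃ (H' : Scheme.{0}) (g : H' ⟶ H), IsProper g ∧ IsIntegral H' ∧ Scheme.IsRegular H' ∧
      Function.Surjective g.base ∧ ∃ U : H.Opens, Dense (U : Set H) ∧ IsFinite (g ∣_ U) ∧
        UniversallyInjective (g ∣_ U) := by
  haveI : IsProper (projectiveSpace (n + 1) k).hom := isProper_projectiveSpace (n + 1) k
  haveI : IsProper (ι ≫ (projectiveSpace (n + 1) k).hom) := inferInstance
  refine pialtConclusion_of_dim_le_three hCP k H (ι ≫ (projectiveSpace (n + 1) k).hom) ?_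
  rw [hdim]
  exact_mod_cast hn

end Summit.ResolutionOfSingularities.ResolutionOfSingularities.Theorems.Pialt.OpenRange

end
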